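import Summits.QuantumFields.BalabanUV.T4Continuum.Support.ShellMeasureLandauWilsonSquaresLocatedSchwarz
import Summits.QuantumFields.BalabanUV.T4Continuum.Support.ShellMeasureLandauPinnedKernels

/-!
# `T4Continuum.ShellMeasureLandauWilsonSquaresKernelsSchwarz` — row S85 f2, file 4: THE LOCATED TWO-RADII WILSON SUPPLIER AT
# THE READING OF RECORD WITH EVERY PINNED CHAIN BINDER INHABITED (file 2 ∘ S81), and with the four linear letters' pinned
# bounds read from DISPLAYED DECAY KERNELS (∘ S69 (A)) — the twin of leaf-04-g7's S80 f2 `ShellMeasureLandauWilsonSquaresKernels`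
(cell `pub-balaban`, sub-cell `t4`, spine estimate NE7c (node U5b); NE7c ROUND-2 crew, unit
`b2b-balaban-t4-ne7c-formalise-leaf-09` gen 12; owner table `t4/b2b-balaban-t4-ne7c-p1/LEAVES-NE7c-P1.md` row **S85 f2** (R-ne7cp1-g32-2
(b), R-ne7cp1-g32-4; coordination with leaf-04-g7 settled on the journal l.18286 → l.18354: leaf-09 hosts the final END and
inlines the S81 composition); THE PATTERN IS leaf-04-g7's (p228956 §1∕§2) — this file is generated from that tree file by
located text substitutions (`hSr` ↦ `h2S`, the supplier call, the constant) and credits it; ADDITIVE — imports this row's file 2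
`ShellMeasureLandauWilsonSquaresLocatedSchwarz` (p228788: `hE_landau_wilsonSquares_located_schwarz`) and leaf-07-g7's S81 f2
`ShellMeasureLandauPinnedKernels` (p227859; hence S81 f1, S75, S69) ONLY; [folklore]; 0 `def`, 0 `def … : Prop`, 0 sorry,
0 citation tags)

HONEST FRAMING.  Finite four-torus programme, rung (B)+1 only — NOT infinite volume, NOT a mass gap, NOT the Clay
problem, NOT summit progress; (B), `BetaPertHyp`, (B^μ) not consumed.  NE7c (`T4IndicatorShell.ShellWeightBound`) is
NOT PRINTED in [Balaban 1983–89] and NOT PROVED; «NE7c ⇐ the named binders» (trigger c3).  Nothing printed is asserted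
here; equation numbers are LOCATORS of displayed TYPES; no estimate of Bałaban's is discharged.  PLUMBING on OUR side:
two compositions BY NAME of landed declarations, carrying the owner's audit γ6 «COUPLING» (N-ne7cp1-g32-1: the Wilson slot
constant SECOND ORDER in the window, no `1∕(r_Φ∕S − 1)`; NOT a K-uniformity failure) together with S81's inhabitation of the
six pinned chain binders.  HONEST DEPENDENCY (cell): continuum YM on T⁴ ⇐ BetaPertH ∧ nine spine estimates (0/9 proved);
BetaPertH ⇐ (D1) ∧ (D4) ∧ CAP+tail; G-an2-4 gates asym, D1 and NE2/3/4.

WHAT IS PROVED ([folklore]; leaf-04-g7's p228956 statements VERBATIM except `hSr : S < r_Φ` ↦ `h2S : 2S ≤ r_Φ` and the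
conclusion's constant `3·(|β|·((d̄ + S̄)·S̄)·K)∕(r_Φ∕S − 1)` ↦ `3·(|β|·((d̄ + 2S̄∕(r_Φ∕S))·(2S̄∕(r_Φ∕S)))·K)`):
* §1 **`hE_landau_wilsonSquares_located_schwarz_of_kernels`** := file 2 `hE_landau_wilsonSquares_located_schwarz` with
  `𝒵 := Λz → ℭ`, `𝒴′ := Λ′ → 𝔄′`, `𝒳 := Λx → 𝔅`, `ℬ := Λb → 𝔇`, `𝒢 ι H H₁ := kerOp k𝒢 ∕ kι ∕ kH ∕ kH₁`, conjugate bounds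
  `B_𝒢p c_ι B_H B₁ₚ` (S69 (A)'s OUTPUT SHAPE, DISPLAYED), `hGWp := S81 f2 hGWp_of_local` (`q_W = B_𝒢p·(2C₄a₃e^{δ′r_W})`),
  `hCp := S81 f1 hCp_of_local` (Sect. C at `R∕2`, so `hRC : 6(ε₄ + B₀b) ≤ R`; `L_C = 2C₂R·e^{δ′r_C}`),
  `hιp hHp hH₁p := norm_conj_kerOp_le`, `hΦp := hΦp_of_support` (`b_p := b`).
* §2 **`hE_landau_wilsonSquares_located_schwarz_of_decay`** := §1 with the four conjugate bounds DISCHARGED by S69 (A)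
  `opNorm_kerOpPin_le` from displayed decay kernels + reduced-rate row sums — so the Wilson supplier's located inputs read:
  the flat printed-TYPE lists, four decay kernels with row sums, two localities with reaches, one block support, the blind
  flat read-outs and the located count `K` — NOTHING PINNED LEFT DISPLAYED, budget LOCATED and SECOND ORDER.
CONSUMER.  File 5 `ShellMeasureLandauEndRayStokesAssembledDecay` (S76 f2's `hEW` slot per exterior section `V`).
η-BOOKKEEPING (N-ne7cp1-g31-3): as leaf-04-g7's file and S81 f2 — `c₀·M` η-free only as the product (S79).  DISPLAYED, NOT
DISCHARGED (c2): the decay kernels, the flat lists, the localities, W-c [dict]; nothing of Bałaban's at a live level is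
discharged; NOTHING in the countdown moves; NE7c NOT PROVED; spine PROVED 0∕9.
-/

noncomputable section

open Set Metric NormedSpace
open scoped Matrix

namespace Summit.QuantumFields.BalabanUV.T4Continuum.ShellMeasureLandauWilsonSquaresKernelsSchwarz

open Literature.MathematicalPhysics.QuantumFieldTheory.Balaban1983to89
open B11Prop6Scheme (Prop4Hyp)
open T4ShellMeasurePlaquette (expTail₂)
open Summit.QuantumFields.BalabanUV.T4Continuum.ShellMeasureMultiGridNorms (WSup)
open Summit.QuantumFields.BalabanUV.T4Continuum.ShellMeasureDecayKernelSums (kerOp)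
open Summit.QuantumFields.BalabanUV.T4Continuum.ShellMeasurePinnedNorm (pinW kerOpPin opNorm_kerOpPin_le)
open Summit.QuantumFields.BalabanUV.T4Continuum.ShellMeasureLandauHolonomy (solAt landauExp)
open Summit.QuantumFields.BalabanUV.T4Continuum.ShellMeasureLandauHolonomyChart (holOf cplx)
open Summit.QuantumFields.BalabanUV.T4Continuum.ShellMeasureLandauPinnedLipschitz (hCp_of_local)
open Summit.QuantumFields.BalabanUV.T4Continuum.ShellMeasureLandauPinnedKernels (norm_conj_kerOp_le hGWp_of_local
  hΦp_of_support)
open Summit.QuantumFields.BalabanUV.T4Continuum.ShellMeasureLandauWilsonSquaresLocatedSchwarz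
  (hE_landau_wilsonSquares_located_schwarz)

variable {Λ Λz Λ' Λx Λb : Type*} [Fintype Λ] [DecidableEq Λ] [Fintype Λz] [Fintype Λ'] [Fintype Λx] [Fintype Λb]
variable {𝔄 ℭ 𝔄' 𝔅 𝔇 : Type*} [NormedAddCommGroup 𝔄] [NormedSpace ℂ 𝔄] [CompleteSpace 𝔄]
  [NormedAddCommGroup ℭ] [NormedSpace ℂ ℭ] [NormedAddCommGroup 𝔄'] [NormedSpace ℂ 𝔄']
  [NormedAddCommGroup 𝔅] [NormedSpace ℂ 𝔅] [CompleteSpace 𝔅] [NormedAddCommGroup 𝔇] [NormedSpace ℂ 𝔇]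
variable {nM : Type*} [Fintype nM] [DecidableEq nM] [Nonempty nM]

/-! ## §1 File 2 (S74 f3 at two radii) with the six pinned chain binders inhabited by S81 -/

section Kernels

open scoped Matrix.Norms.L2Operator

/-- **END-II's `hE` FOR THE WILSON PART, FULLY LOCATED, AT THE READING OF RECORD, TWO RADII — EVERY PINNED CHAIN BINDER
INHABITED** (the two-radii twin of leaf-04-g7's S80 f2 `ShellMeasureLandauWilsonSquaresKernels.hE_landau_wilsonSquares_located_of_kernels`,
in exactly its pattern).  This row's file 2 `hE_landau_wilsonSquares_located_schwarz` with all five chain spaces FLAT pi-types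
(`Λ → 𝔄`, `Λz → ℭ`, `Λ′ → 𝔄′`, `Λx → 𝔅`, `Λb → 𝔇`; sup norms), readings `(toPiL (pinW δ′ ϖ·) 1).symm` with pins
`ϖ ϖz ϖ′ ϖx ϖb`, `δ′ ≥ 0`.  FLAT lists VERBATIM ((P2) `h𝒢`, (P4) `hW`, (118)∕(121) at `a = B₀b`, (103) `hH₁`, (75)-TYPE
`hΦd`∕`hΦ0`∕`hΦ`, (44) `hCq`∕`hCd` AT RADIUS `R` with **`hRC : 6(ε₄ + B₀b) ≤ R`** (Sect. C is run at `R∕2`), scaling `hι`, (46)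
`hH`, (54) `hq`) with the located number **`h2S : 2S ≤ r_Φ`** (S85's inner radius); the four LINEAR letters AS KERNEL OPERATORS
`kerOp k𝒢 ∕ kι ∕ kH ∕ kH₁` with bounds `B_𝒢p c_ι B_H B₁ₚ` on their S69 conjugates (S69 (A)'s OUTPUT SHAPE — DISPLAYED decay
halves); LOCALITY of the (P4) letter (`NW`, reach `r_W`) and of the (44) letter (`NC`, reach `r_C`); the coarse field SUPPORTED
ON THE BLOCK `{ϖb ≤ 0}`; smallness `B_𝒢p·(2C₄a₃e^{δ′r_W}) < 1`, `2C₂R·e^{δ′r_C}·c_ι·B_H < 1`; the weight read-outs (blind off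
`supp p` at depth `ϖP p ≥ 0`, flat op-norms `κ̄_w`, curl op-norm `κ̄_c`, lengths `≤ m_w`, skew on `𝓡𝒴`), the real structure,
the unitary background plaquettes `‖B_p − 1‖ ≤ d_p ≤ d̄` and the located count `Σ_p e^{−δ′ϖP p} ≤ K` VERBATIM.  The six pinned
chain binders are supplied IN-PROOF by S81 (f2 `hGWp_of_local`, f1 `hCp_of_local`, f2 `norm_conj_kerOp_le` ×3, `hΦp_of_support`)
BY NAME.  CONCLUSION: END-II's `hE` for the Wilson ray profile `𝓔_W y := Σ_{p∈P_w} β(1 − Re tr(B_p·holOf (ℓw p) Z y)∕N)` with the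
SECOND-ORDER located constant **`B_𝓔 = 3·|β|·((d̄ + 2S̄∕(r_Φ∕S))·(2S̄∕(r_Φ∕S)))·K`** (no `1∕(r_Φ∕S − 1)`),
`S̄ = κ̄_c z_pin + expTail₂(m_w(κ̄_w z_pin))`, `z_pin = B₁ₚ·b∕((1 − B_𝒢p·(2C₄a₃e^{δ′r_W}))(1 − 2C₂R·e^{δ′r_C}·c_ι·B_H))`.
Nothing printed is asserted; no estimate of Bałaban's discharged; NE7c NOT PROVED. [folklore] -/
theorem hE_landau_wilsonSquares_located_schwarz_of_kernels {n : ℕ} {𝔭 : Type*} {W : Set (Fin n → ℝ)} {Pw : Finset 𝔭} {S : ℝ}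
    (hS : 0 < S) (hWS : W ⊆ closedBall (0 : Fin n → ℝ) S)
    {δ' : ℝ} (hδ' : 0 ≤ δ') (ϖ : Λ → ℝ) (ϖz : Λz → ℝ) (ϖ' : Λ' → ℝ) (ϖx : Λx → ℝ) (ϖb : Λb → ℝ)
    -- the four linear letters as kernel operators, with bounds on their S69 conjugates (DISPLAYED decay halves)
    (k𝒢 : Λ → Λz → (ℭ →L[ℂ] 𝔄)) (kι : Λ' → Λ → (𝔄 →L[ℂ] 𝔄')) (kH : Λ → Λx → (𝔅 →L[ℂ] 𝔄))
    (kH₁ : Λ → Λb → (𝔇 →L[ℂ] 𝔄)) {B𝒢p cι BH B₁p : ℝ} (hB𝒢p : 0 ≤ B𝒢p) (hcι : 0 ≤ cι) (hBH : 0 ≤ BH)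
    (hB₁p : 0 ≤ B₁p) (h𝒢p : ‖kerOpPin k𝒢 δ' ϖz ϖ‖ ≤ B𝒢p) (hιp : ‖kerOpPin kι δ' ϖ ϖ'‖ ≤ cι)
    (hHp : ‖kerOpPin kH δ' ϖx ϖ‖ ≤ BH) (hH₁p : ‖kerOpPin kH₁ δ' ϖb ϖ‖ ≤ B₁p)
    -- the flat lists
    {W𝒱 : (Λ → 𝔄) → (Λz → ℭ)} {B₀ C₄ a₃ ε₄ b : ℝ}
    (h𝒢 : ∀ f, ‖kerOp k𝒢 f‖ ≤ B₀ * ‖f‖) (hW : Prop4Hyp W𝒱 C₄ a₃) (hB₀ : 0 < B₀) (hC₄ : 0 ≤ C₄) (hε₄ : 0 ≤ ε₄)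
    (hdom : 2 * (ε₄ + B₀ * b) ≤ a₃) (hself : B₀ * C₄ * (ε₄ + B₀ * b) ^ 2 ≤ ε₄)
    (hcontr : 4 * B₀ * C₄ * (ε₄ + B₀ * b) < 1) (hH₁ : ∀ B, ‖kerOp kH₁ B‖ ≤ B₀ * ‖B‖)
    {Φ : (Fin n → ℂ) → (Λb → 𝔇)} {rΦ : ℝ} (hΦd : DifferentiableOn ℂ Φ (ball 0 rΦ)) (hΦ0 : Φ 0 = 0)
    (hΦ : ∀ z ∈ ball (0 : Fin n → ℂ) rΦ, ‖Φ z‖ < b) (h2S : 2 * S ≤ rΦ)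
    {C : (Λ' → 𝔄') → (Λx → 𝔅)} {C₂ R : ℝ} (hC₂ : 0 ≤ C₂) (hCq : ∀ Z : Λ' → 𝔄', ‖Z‖ < R → ‖C Z‖ ≤ C₂ * ‖Z‖ ^ 2)
    (hCd : DifferentiableOn ℂ C (ball 0 R)) (hι : ∀ Y, ‖kerOp kι Y‖ ≤ ‖Y‖) (hH : ∀ X, ‖kerOp kH X‖ ≤ B₀ * ‖X‖)
    (hq : 9 * C₂ * B₀ * (ε₄ + B₀ * b) < 1) (hRC : 6 * (ε₄ + B₀ * b) ≤ R)
    -- localities with reaches (in place of `hGWp`'s `W`-half and of `hCp`) and the block support (in place of `hΦp`)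
    (NW : Λz → Λ → Prop) (hlocW : ∀ A A' : Λ → 𝔄, ∀ c, (∀ b', NW c b' → A b' = A' b') → W𝒱 A c = W𝒱 A' c)
    {rW : ℝ} (hreachW : ∀ c b', NW c b' → ϖz c - rW ≤ ϖ b')
    (NC : Λx → Λ' → Prop) (hlocC : ∀ A A' : Λ' → 𝔄', ∀ c, (∀ b', NC c b' → A b' = A' b') → C A c = C A' c)
    {rC : ℝ} (hreachC : ∀ c b', NC c b' → ϖx c - rC ≤ ϖ' b')
    (hsupp : ∀ z : Fin n → ℂ, ∀ i, 0 < ϖb i → Φ z i = 0)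
    -- smallness of the two contraction numbers in the pinned currency (DISPLAYED arithmetic)
    (hqW : B𝒢p * (2 * C₄ * a₃ * Real.exp (δ' * rW)) < 1) (hk : 2 * C₂ * R * Real.exp (δ' * rC) * cι * BH < 1)
    -- the weight read-outs: BLIND off located supports, FLAT op-norms, curl op-norm (DISPLAYED), lengths
    (ℓw : 𝔭 → List ((Λ → 𝔄) →L[ℂ] Matrix nM nM ℂ)) (supp : 𝔭 → Finset Λ) (ϖP : 𝔭 → ℝ)
    (hblind : ∀ p ∈ Pw, ∀ ℓ ∈ ℓw p, ∀ A A' : Λ → 𝔄, (∀ b' ∈ supp p, A b' = A' b') → ℓ A = ℓ A')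
    (hdepth : ∀ p ∈ Pw, ∀ b' ∈ supp p, ϖP p ≤ ϖ b') (hϖP : ∀ p ∈ Pw, 0 ≤ ϖP p)
    {κw' κc' : ℝ} (hκw' : 0 ≤ κw') (hκc' : 0 ≤ κc') (hℓw : ∀ p ∈ Pw, ∀ ℓ ∈ ℓw p, ‖ℓ‖ ≤ κw')
    (hcurl : ∀ p ∈ Pw, ‖(ℓw p).sum‖ ≤ κc')
    {mw : ℕ} (hlenw : ∀ p ∈ Pw, (ℓw p).length ≤ mw)
    -- the real structure (chain (A)) with SKEW weight read-outs (chain (E))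
    (𝓡𝒴 : AddSubgroup (Λ → 𝔄)) (h𝓡𝒴 : IsClosed (𝓡𝒴 : Set (Λ → 𝔄))) (𝓡𝒵 : AddSubgroup (Λz → ℭ))
    (𝓡𝒴' : AddSubgroup (Λ' → 𝔄')) (𝓡𝒳 : AddSubgroup (Λx → 𝔅)) (h𝓡𝒳 : IsClosed (𝓡𝒳 : Set (Λx → 𝔅)))
    (𝓡ℬ : AddSubgroup (Λb → 𝔇))
    (h𝒢r : ∀ f ∈ 𝓡𝒵, kerOp k𝒢 f ∈ 𝓡𝒴) (hWr : ∀ Y ∈ 𝓡𝒴, W𝒱 Y ∈ 𝓡𝒵) (hιr : ∀ Y ∈ 𝓡𝒴, kerOp kι Y ∈ 𝓡𝒴')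
    (hHr : ∀ X ∈ 𝓡𝒳, kerOp kH X ∈ 𝓡𝒴) (hCr : ∀ Z ∈ 𝓡𝒴', C Z ∈ 𝓡𝒳) (hH₁r : ∀ B ∈ 𝓡ℬ, kerOp kH₁ B ∈ 𝓡𝒴)
    (hΦr : ∀ y : Fin n → ℝ, ‖y‖ ≤ S → Φ (cplx y) ∈ 𝓡ℬ)
    (hskew : ∀ p ∈ Pw, ∀ ℓ ∈ ℓw p, ∀ Y ∈ 𝓡𝒴, ℓ Y ∈ skewAdjoint (Matrix nM nM ℂ))
    -- the frozen background plaquettes (N-ne7cp1-g31-2) and the located count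
    (Bp : 𝔭 → Matrix nM nM ℂ) {d : 𝔭 → ℝ} {dbar : ℝ} (hBu : ∀ p ∈ Pw, Bp p ∈ unitary (Matrix nM nM ℂ))
    (hBd : ∀ p ∈ Pw, ‖Bp p - 1‖ ≤ d p) (hd : ∀ p ∈ Pw, d p ≤ dbar) (hdbar : 0 ≤ dbar)
    {K : ℝ} (hK : ∑ p ∈ Pw, Real.exp (-(δ' * ϖP p)) ≤ K) (β : ℝ) :
    ∀ x ∈ W, ∀ c : ℝ, 1 / 2 ≤ c → c ≤ 1 →
      (fun y => ∑ p ∈ Pw, β * (1 - (Matrix.trace (Bp p * holOf (ℓw p) (fun y => landauExp C (kerOp kι) (kerOp kH)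
        (4 * C₂ * (ε₄ + B₀ * b) ^ 2) (solAt (kerOp k𝒢) 0 W𝒱 ε₄ (0 : Λz → ℭ) (kerOp kH₁ (Φ (cplx y))) +
          kerOp kH₁ (Φ (cplx y)))) y)).re / Fintype.card nM)) (c • x) ≤
      (fun y => ∑ p ∈ Pw, β * (1 - (Matrix.trace (Bp p * holOf (ℓw p) (fun y => landauExp C (kerOp kι) (kerOp kH)
        (4 * C₂ * (ε₄ + B₀ * b) ^ 2) (solAt (kerOp k𝒢) 0 W𝒱 ε₄ (0 : Λz → ℭ) (kerOp kH₁ (Φ (cplx y))) +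
          kerOp kH₁ (Φ (cplx y)))) y)).re / Fintype.card nM)) x +
        (1 - c) * (3 * (|β| * ((dbar +
          2 * (κc' * (B₁p * b / ((1 - B𝒢p * (2 * C₄ * a₃ * Real.exp (δ' * rW))) *
              (1 - 2 * C₂ * R * Real.exp (δ' * rC) * cι * BH))) +
            expTail₂ (mw * (κw' * (B₁p * b / ((1 - B𝒢p * (2 * C₄ * a₃ * Real.exp (δ' * rW))) *
              (1 - 2 * C₂ * R * Real.exp (δ' * rC) * cι * BH)))))) / (rΦ / S)) *
          (2 * (κc' * (B₁p * b / ((1 - B𝒢p * (2 * C₄ * a₃ * Real.exp (δ' * rW))) *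
              (1 - 2 * C₂ * R * Real.exp (δ' * rC) * cι * BH))) +
            expTail₂ (mw * (κw' * (B₁p * b / ((1 - B𝒢p * (2 * C₄ * a₃ * Real.exp (δ' * rW))) *
              (1 - 2 * C₂ * R * Real.exp (δ' * rC) * cι * BH)))))) / (rΦ / S))) * K)) := by
  have hrΦ : 0 < rΦ := by linarith
  have hb : 0 < b := by have h := hΦ 0 (mem_ball_self hrΦ); rwa [hΦ0, norm_zero] at h
  have hε : 0 < ε₄ + B₀ * b := add_pos_of_nonneg_of_pos hε₄ (mul_pos hB₀ hb)
  have hR : 0 < R := by linarith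
  -- Sect. C's flat list at radius `R∕2`
  have hCq' : ∀ Z : Λ' → 𝔄', ‖Z‖ < R / 2 → ‖C Z‖ ≤ C₂ * ‖Z‖ ^ 2 := fun Z hZ => hCq Z (hZ.trans (by linarith))
  have hCd' : DifferentiableOn ℂ C (ball 0 (R / 2)) := hCd.mono (ball_subset_ball (by linarith))
  have hRC' : 3 * (ε₄ + B₀ * b) ≤ R / 2 := by linarith
  -- the six pinned chain binders, inhabited by S81
  have hGWp := hGWp_of_local hδ' ϖ ϖz k𝒢 hB𝒢p h𝒢p NW hlocW hreachW hC₄ hdom hε hW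
  have hCp := hCp_of_local hδ' ϖ' ϖx NC hlocC hreachC hC₂ hR hCq hCd
  have hk' : 2 * C₂ * R * Real.exp (δ' * rC) * cι * BH < 1 := hk
  exact hE_landau_wilsonSquares_located_schwarz hS hWS h𝒢 hW hB₀ hC₄ hε₄ hdom hself hcontr (kerOp kH₁) hH₁ hΦd hΦ0 hΦ h2S
    hC₂ hCq' hCd' (kerOp kι) hι (kerOp kH) hH hq hRC' hδ' ϖ
    (WSup.toPiL (𝔄 := 𝔄') (pinW δ' ϖ') 1).symm.toContinuousLinearMap
    (WSup.toPiL (𝔄 := 𝔅) (pinW δ' ϖx) 1).symm.toContinuousLinearMap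
    (WSup.toPiL (𝔄 := 𝔇) (pinW δ' ϖb) 1).symm.toContinuousLinearMap hGWp hqW
    (fun A A' hA hA' => by simpa only [ContinuousLinearEquiv.coe_coe] using hCp A A' hA hA')
    (fun Y => by simpa only [ContinuousLinearEquiv.coe_coe] using norm_conj_kerOp_le kι δ' ϖ ϖ' hιp Y)
    (fun X => by simpa only [ContinuousLinearEquiv.coe_coe] using norm_conj_kerOp_le kH δ' ϖx ϖ hHp X)
    (by positivity) hcι hBH hk' hB₁p
    (fun B => by simpa only [ContinuousLinearEquiv.coe_coe] using norm_conj_kerOp_le kH₁ δ' ϖb ϖ hH₁p B)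
    (fun z hz => by simpa only [ContinuousLinearEquiv.coe_coe] using hΦp_of_support hδ' ϖb hsupp hΦ z hz) hb.le
    ℓw supp ϖP hblind hdepth hϖP hκw' hκc' hℓw hcurl hlenw 𝓡𝒴 h𝓡𝒴 𝓡𝒵 𝓡𝒴' 𝓡𝒳 h𝓡𝒳 𝓡ℬ h𝒢r hWr hιr hHr hCr hH₁r
    hΦr hskew Bp hBu hBd hd hdbar hK β

end Kernels

/-! ## §2 … and with the four linear letters' pinned bounds read from displayed decay kernels (S69 (A)) -/

section Decay

open scoped Matrix.Norms.L2Operator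

variable {𝔖 : Type*}

/-- **THE LOCATED TWO-RADII WILSON SUPPLIER WITH NOTHING PINNED LEFT DISPLAYED** (twin of leaf-04-g7's
`hE_landau_wilsonSquares_located_of_decay`).  §1 with ONE pin profile `ϖ : 𝔖 → ℝ` on a common position space, one-sided
`ρ`-Lipschitz (`ϖ x ≤ ϖ y + ρ x y`), composed with the position maps `pos posz pos′ posx posb` of the five index types, and the
four conjugate bounds DISCHARGED by S69 (A) `opNorm_kerOpPin_le` from DISPLAYED DECAY KERNELS `‖k c b‖ ≤ c₀·e^{−δρ(pos c, pos b)}`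
((3.133)∕Thm 3.3, (46), (103) decay-halves TYPE — LOCATORS, not assertions) with reduced-rate row sums
`Σ_b e^{−(δ−δ′)ρ(x, pos b)} ≤ M` per letter: `B_𝒢p := c_𝒢M_𝒢`, `c_ι := c_ιM_ι`, `B_H := c_HM_H`, `B₁ₚ := c₁M₁`.  CONCLUSION = §1's
with these products (`2S ≤ r_Φ`; constant `3·|β|·((d̄ + 2S̄∕(r_Φ∕S))·(2S̄∕(r_Φ∕S)))·K`,
`z_pin = (c₁M₁)·b∕((1 − (c_𝒢M_𝒢)·(2C₄a₃e^{δ′r_W}))(1 − 2C₂R·e^{δ′r_C}·(c_ιM_ι)·(c_HM_H)))`) — the (T2) supplier of the final host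
`ShellMeasureLandauEndRayStokesAssembledDecay`.  Nothing printed is asserted; no estimate of Bałaban's discharged; NE7c NOT
PROVED. [folklore] -/
theorem hE_landau_wilsonSquares_located_schwarz_of_decay {n : ℕ} {𝔭 : Type*} {W : Set (Fin n → ℝ)} {Pw : Finset 𝔭} {S : ℝ}
    (hS : 0 < S) (hWS : W ⊆ closedBall (0 : Fin n → ℝ) S)
    {δ' : ℝ} (hδ' : 0 ≤ δ') (ϖ : 𝔖 → ℝ) (ρ : 𝔖 → 𝔖 → ℝ) (hϖ : ∀ x y, ϖ x ≤ ϖ y + ρ x y)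
    (pos : Λ → 𝔖) (posz : Λz → 𝔖) (pos' : Λ' → 𝔖) (posx : Λx → 𝔖) (posb : Λb → 𝔖)
    -- the four linear letters as DECAY KERNELS with reduced-rate row sums (DISPLAYED)
    (k𝒢 : Λ → Λz → (ℭ →L[ℂ] 𝔄)) (kι : Λ' → Λ → (𝔄 →L[ℂ] 𝔄')) (kH : Λ → Λx → (𝔅 →L[ℂ] 𝔄))
    (kH₁ : Λ → Λb → (𝔇 →L[ℂ] 𝔄)) {c𝒢 δ𝒢 M𝒢 cι δι Mι cH δH MH c₁ δ₁ M₁ : ℝ}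
    (hc𝒢 : 0 ≤ c𝒢) (hM𝒢 : 0 ≤ M𝒢) (hk𝒢 : ∀ c b', ‖k𝒢 c b'‖ ≤ c𝒢 * Real.exp (-(δ𝒢 * ρ (pos c) (posz b'))))
    (hM𝒢' : ∀ x, ∑ b', Real.exp (-((δ𝒢 - δ') * ρ x (posz b'))) ≤ M𝒢)
    (hcι : 0 ≤ cι) (hMι : 0 ≤ Mι) (hkι : ∀ c b', ‖kι c b'‖ ≤ cι * Real.exp (-(δι * ρ (pos' c) (pos b'))))
    (hMι' : ∀ x, ∑ b', Real.exp (-((δι - δ') * ρ x (pos b'))) ≤ Mι)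
    (hcH : 0 ≤ cH) (hMH : 0 ≤ MH) (hkH : ∀ c b', ‖kH c b'‖ ≤ cH * Real.exp (-(δH * ρ (pos c) (posx b'))))
    (hMH' : ∀ x, ∑ b', Real.exp (-((δH - δ') * ρ x (posx b'))) ≤ MH)
    (hc₁ : 0 ≤ c₁) (hM₁ : 0 ≤ M₁) (hkH₁ : ∀ c b', ‖kH₁ c b'‖ ≤ c₁ * Real.exp (-(δ₁ * ρ (pos c) (posb b'))))
    (hM₁' : ∀ x, ∑ b', Real.exp (-((δ₁ - δ') * ρ x (posb b'))) ≤ M₁)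
    -- the flat lists
    {W𝒱 : (Λ → 𝔄) → (Λz → ℭ)} {B₀ C₄ a₃ ε₄ b : ℝ}
    (h𝒢 : ∀ f, ‖kerOp k𝒢 f‖ ≤ B₀ * ‖f‖) (hW : Prop4Hyp W𝒱 C₄ a₃) (hB₀ : 0 < B₀) (hC₄ : 0 ≤ C₄) (hε₄ : 0 ≤ ε₄)
    (hdom : 2 * (ε₄ + B₀ * b) ≤ a₃) (hself : B₀ * C₄ * (ε₄ + B₀ * b) ^ 2 ≤ ε₄)
    (hcontr : 4 * B₀ * C₄ * (ε₄ + B₀ * b) < 1) (hH₁ : ∀ B, ‖kerOp kH₁ B‖ ≤ B₀ * ‖B‖)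
    {Φ : (Fin n → ℂ) → (Λb → 𝔇)} {rΦ : ℝ} (hΦd : DifferentiableOn ℂ Φ (ball 0 rΦ)) (hΦ0 : Φ 0 = 0)
    (hΦ : ∀ z ∈ ball (0 : Fin n → ℂ) rΦ, ‖Φ z‖ < b) (h2S : 2 * S ≤ rΦ)
    {C : (Λ' → 𝔄') → (Λx → 𝔅)} {C₂ R : ℝ} (hC₂ : 0 ≤ C₂) (hCq : ∀ Z : Λ' → 𝔄', ‖Z‖ < R → ‖C Z‖ ≤ C₂ * ‖Z‖ ^ 2)
    (hCd : DifferentiableOn ℂ C (ball 0 R)) (hι : ∀ Y, ‖kerOp kι Y‖ ≤ ‖Y‖) (hH : ∀ X, ‖kerOp kH X‖ ≤ B₀ * ‖X‖)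
    (hq : 9 * C₂ * B₀ * (ε₄ + B₀ * b) < 1) (hRC : 6 * (ε₄ + B₀ * b) ≤ R)
    -- localities with reaches and the block support
    (NW : Λz → Λ → Prop) (hlocW : ∀ A A' : Λ → 𝔄, ∀ c, (∀ b', NW c b' → A b' = A' b') → W𝒱 A c = W𝒱 A' c)
    {rW : ℝ} (hreachW : ∀ c b', NW c b' → ϖ (posz c) - rW ≤ ϖ (pos b'))
    (NC : Λx → Λ' → Prop) (hlocC : ∀ A A' : Λ' → 𝔄', ∀ c, (∀ b', NC c b' → A b' = A' b') → C A c = C A' c)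
    {rC : ℝ} (hreachC : ∀ c b', NC c b' → ϖ (posx c) - rC ≤ ϖ (pos' b'))
    (hsupp : ∀ z : Fin n → ℂ, ∀ i, 0 < ϖ (posb i) → Φ z i = 0)
    -- smallness of the two contraction numbers (DISPLAYED arithmetic on the decay constants)
    (hqW : c𝒢 * M𝒢 * (2 * C₄ * a₃ * Real.exp (δ' * rW)) < 1)
    (hk : 2 * C₂ * R * Real.exp (δ' * rC) * (cι * Mι) * (cH * MH) < 1)
    -- the weight read-outs: BLIND off located supports, FLAT op-norms, curl op-norm (DISPLAYED), lengths
    (ℓw : 𝔭 → List ((Λ → 𝔄) →L[ℂ] Matrix nM nM ℂ)) (supp : 𝔭 → Finset Λ) (ϖP : 𝔭 → ℝ)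
    (hblind : ∀ p ∈ Pw, ∀ ℓ ∈ ℓw p, ∀ A A' : Λ → 𝔄, (∀ b' ∈ supp p, A b' = A' b') → ℓ A = ℓ A')
    (hdepth : ∀ p ∈ Pw, ∀ b' ∈ supp p, ϖP p ≤ ϖ (pos b')) (hϖP : ∀ p ∈ Pw, 0 ≤ ϖP p)
    {κw' κc' : ℝ} (hκw' : 0 ≤ κw') (hκc' : 0 ≤ κc') (hℓw : ∀ p ∈ Pw, ∀ ℓ ∈ ℓw p, ‖ℓ‖ ≤ κw')
    (hcurl : ∀ p ∈ Pw, ‖(ℓw p).sum‖ ≤ κc')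
    {mw : ℕ} (hlenw : ∀ p ∈ Pw, (ℓw p).length ≤ mw)
    -- the real structure (chain (A)) with SKEW weight read-outs (chain (E))
    (𝓡𝒴 : AddSubgroup (Λ → 𝔄)) (h𝓡𝒴 : IsClosed (𝓡𝒴 : Set (Λ → 𝔄))) (𝓡𝒵 : AddSubgroup (Λz → ℭ))
    (𝓡𝒴' : AddSubgroup (Λ' → 𝔄')) (𝓡𝒳 : AddSubgroup (Λx → 𝔅)) (h𝓡𝒳 : IsClosed (𝓡𝒳 : Set (Λx → 𝔅)))
    (𝓡ℬ : AddSubgroup (Λb → 𝔇))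
    (h𝒢r : ∀ f ∈ 𝓡𝒵, kerOp k𝒢 f ∈ 𝓡𝒴) (hWr : ∀ Y ∈ 𝓡𝒴, W𝒱 Y ∈ 𝓡𝒵) (hιr : ∀ Y ∈ 𝓡𝒴, kerOp kι Y ∈ 𝓡𝒴')
    (hHr : ∀ X ∈ 𝓡𝒳, kerOp kH X ∈ 𝓡𝒴) (hCr : ∀ Z ∈ 𝓡𝒴', C Z ∈ 𝓡𝒳) (hH₁r : ∀ B ∈ 𝓡ℬ, kerOp kH₁ B ∈ 𝓡𝒴)
    (hΦr : ∀ y : Fin n → ℝ, ‖y‖ ≤ S → Φ (cplx y) ∈ 𝓡ℬ)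
    (hskew : ∀ p ∈ Pw, ∀ ℓ ∈ ℓw p, ∀ Y ∈ 𝓡𝒴, ℓ Y ∈ skewAdjoint (Matrix nM nM ℂ))
    -- the frozen background plaquettes (N-ne7cp1-g31-2) and the located count
    (Bp : 𝔭 → Matrix nM nM ℂ) {d : 𝔭 → ℝ} {dbar : ℝ} (hBu : ∀ p ∈ Pw, Bp p ∈ unitary (Matrix nM nM ℂ))
    (hBd : ∀ p ∈ Pw, ‖Bp p - 1‖ ≤ d p) (hd : ∀ p ∈ Pw, d p ≤ dbar) (hdbar : 0 ≤ dbar)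
    {K : ℝ} (hK : ∑ p ∈ Pw, Real.exp (-(δ' * ϖP p)) ≤ K) (β : ℝ) :
    ∀ x ∈ W, ∀ c : ℝ, 1 / 2 ≤ c → c ≤ 1 →
      (fun y => ∑ p ∈ Pw, β * (1 - (Matrix.trace (Bp p * holOf (ℓw p) (fun y => landauExp C (kerOp kι) (kerOp kH)
        (4 * C₂ * (ε₄ + B₀ * b) ^ 2) (solAt (kerOp k𝒢) 0 W𝒱 ε₄ (0 : Λz → ℭ) (kerOp kH₁ (Φ (cplx y))) +
          kerOp kH₁ (Φ (cplx y)))) y)).re / Fintype.card nM)) (c • x) ≤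
      (fun y => ∑ p ∈ Pw, β * (1 - (Matrix.trace (Bp p * holOf (ℓw p) (fun y => landauExp C (kerOp kι) (kerOp kH)
        (4 * C₂ * (ε₄ + B₀ * b) ^ 2) (solAt (kerOp k𝒢) 0 W𝒱 ε₄ (0 : Λz → ℭ) (kerOp kH₁ (Φ (cplx y))) +
          kerOp kH₁ (Φ (cplx y)))) y)).re / Fintype.card nM)) x +
        (1 - c) * (3 * (|β| * ((dbar +
          2 * (κc' * (c₁ * M₁ * b / ((1 - c𝒢 * M𝒢 * (2 * C₄ * a₃ * Real.exp (δ' * rW))) *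
              (1 - 2 * C₂ * R * Real.exp (δ' * rC) * (cι * Mι) * (cH * MH)))) +
            expTail₂ (mw * (κw' * (c₁ * M₁ * b / ((1 - c𝒢 * M𝒢 * (2 * C₄ * a₃ * Real.exp (δ' * rW))) *
              (1 - 2 * C₂ * R * Real.exp (δ' * rC) * (cι * Mι) * (cH * MH))))))) / (rΦ / S)) *
          (2 * (κc' * (c₁ * M₁ * b / ((1 - c𝒢 * M𝒢 * (2 * C₄ * a₃ * Real.exp (δ' * rW))) *
              (1 - 2 * C₂ * R * Real.exp (δ' * rC) * (cι * Mι) * (cH * MH)))) +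
            expTail₂ (mw * (κw' * (c₁ * M₁ * b / ((1 - c𝒢 * M𝒢 * (2 * C₄ * a₃ * Real.exp (δ' * rW))) *
              (1 - 2 * C₂ * R * Real.exp (δ' * rC) * (cι * Mι) * (cH * MH))))))) / (rΦ / S))) * K)) := by
  -- the four conjugate bounds from the decay kernels (S69 (A))
  have h𝒢p : ‖kerOpPin k𝒢 δ' (ϖ ∘ posz) (ϖ ∘ pos)‖ ≤ c𝒢 * M𝒢 :=
    opNorm_kerOpPin_le k𝒢 ρ posz pos ϖ hc𝒢 hδ' hM𝒢 hk𝒢 hϖ hM𝒢'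
  have hιp : ‖kerOpPin kι δ' (ϖ ∘ pos) (ϖ ∘ pos')‖ ≤ cι * Mι :=
    opNorm_kerOpPin_le kι ρ pos pos' ϖ hcι hδ' hMι hkι hϖ hMι'
  have hHp : ‖kerOpPin kH δ' (ϖ ∘ posx) (ϖ ∘ pos)‖ ≤ cH * MH :=
    opNorm_kerOpPin_le kH ρ posx pos ϖ hcH hδ' hMH hkH hϖ hMH'
  have hH₁p : ‖kerOpPin kH₁ δ' (ϖ ∘ posb) (ϖ ∘ pos)‖ ≤ c₁ * M₁ :=
    opNorm_kerOpPin_le kH₁ ρ posb pos ϖ hc₁ hδ' hM₁ hkH₁ hϖ hM₁'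
  exact hE_landau_wilsonSquares_located_schwarz_of_kernels hS hWS hδ' (ϖ ∘ pos) (ϖ ∘ posz) (ϖ ∘ pos') (ϖ ∘ posx) (ϖ ∘ posb)
    k𝒢 kι kH kH₁ (mul_nonneg hc𝒢 hM𝒢) (mul_nonneg hcι hMι) (mul_nonneg hcH hMH) (mul_nonneg hc₁ hM₁) h𝒢p hιp hHp
    hH₁p h𝒢 hW hB₀ hC₄ hε₄ hdom hself hcontr hH₁ hΦd hΦ0 hΦ h2S hC₂ hCq hCd hι hH hq hRC NW hlocW hreachW NC hlocC
    hreachC hsupp hqW hk ℓw supp ϖP hblind hdepth hϖP hκw' hκc' hℓw hcurl hlenw 𝓡𝒴 h𝓡𝒴 𝓡𝒵 𝓡𝒴' 𝓡𝒳 h𝓡𝒳 𝓡ℬ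
    h𝒢r hWr hιr hHr hCr hH₁r hΦr hskew Bp hBu hBd hd hdbar hK β

end Decay

end Summit.QuantumFields.BalabanUV.T4Continuum.ShellMeasureLandauWilsonSquaresKernelsSchwarz

end
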